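import Summits.QuantumFields.YangMills.Theorems.F4SubCurvatureDoorLaplaceFourierRegistered
import Summits.QuantumFields.YangMills.Theorems.F4SubCurvatureDoorRationalToGeneralCrossAnalyticity
import Literature.Analysis.Complex.CrossTheoremNStrips
import Mathlib
import HarnessLib

/-!
# S1 programme (⟨stmt-QuantumFields-23125⟩) — rung R-S1×⁺ `QuantitativeCrossAnalyticity` BY NAME

Crux `F4SubCurvatureDoor.RationalToGeneral` ⟨stmt-QuantumFields-23125⟩, owner file `Cruxes/RationalToGeneral/Lines/forward_cone_rungs.lean` v4
(ns `…ForwardConeRungs`).  This file restates R-S1×⁺ `QuantitativeCrossAnalyticity` CHARACTER-IDENTICALLY and proves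
`quantitativeCrossAnalyticity_holds : QuantitativeCrossAnalyticity`.

PROOF (scale covariance of the tree's cross theorem).  `Literature.Analysis.Complex.exists_holomorphic_extension_of_separately_local_fintype` at
`ℓ = 1`, `ι = Fin 4` gives a universal polydisc radius `r₁`.  For data of radius `r` put `s = r/(2(1 + Σ‖vⱼ‖))` and `P(y) = f(x₀ + Σ yⱼ (s vⱼ))` on
the unit cube; the one-variable extensions `w ↦ F(s w)` feed the lemma, which returns `G₁` on the polydisc `r₁` with the same bound `M`.  With the
coordinate matrix `A` of the basis `v` (so `coords_v(w)_k = Σᵢ A_{ki} wᵢ`), `G(z) = G₁(s⁻¹ A (z − x₀))` is holomorphic on the sup-ball of radius `c r`,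
`c = r₁ / (2(1 + Σ‖vⱼ‖)(1 + Σ|A_{ki}|))`, agrees with `f` at real points (`Σ coords_k • v_k = x − x₀`), and is bounded by `M`.

HONEST LABEL: one rung of the S1 programme; `PringsheimIdentification`, `LinearAperture`, `ApertureBootstrap`, S1, ⟨23125⟩, ⟨23035⟩, R2d and the
Yang–Mills mass gap remain OPEN; no summit is proved by a line.
-/

noncomputable section

open MeasureTheory Filter Topology Set Metric
open scoped BigOperators

namespace Summit.QuantumFields.YangMills.Theorems.F4SubCurvatureDoorQuantitativeCrossAnalyticityRegistered

open Summit.QuantumFields.YangMills.Theorems.F4SubCurvatureDoorLaplaceFourierRegistered (E4)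
open Summit.QuantumFields.YangMills.Theorems.F4SubCurvatureDoorCrossAnalyticityRegistered (sum_update_smul dist_sum_smul_lt)

/-- R-S1×⁺ «QUANTITATIVE CROSS THEOREM» (L; Siciak's explicit extension domain `X̂ = {Σ_j h_j(z_j) < 1}` is scale-covariant and the extension obeys
the two-constants bound `‖f̂‖_X̂ ≤ ‖f‖_X`): same hypotheses as `CrossAnalyticity` with `ε = r`, conclusion a holomorphic extension to the complex
ball of radius `c·r` about `x₀` with the SAME bound `M`, `c > 0` depending only on the frame `v`.  This (not the qualitative `CrossAnalyticity`) is what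
`LinearAperture` needs: at `x₀ = t e₀` the data of `DirectionalExtension` have `r ≍ t` and `M = sup_{[t/8, 2t]}` of the axis function `= L_μ(t/8)`
(monotone), so `y⃗ ↦ K(t, iy⃗)` is bounded by `L_μ(t/8)` for `|y⃗| < c' t`, and Vivanti–Pringsheim (non-negative even Taylor coefficients) identifies it
with `∫ e^{−tE} cosh(q⃗·y⃗) dμ`. -/
def QuantitativeCrossAnalyticity : Prop :=
  ∀ (v : Fin 4 → E4), LinearIndependent ℝ v → ∃ c : ℝ, 0 < c ∧
    ∀ (f : E4 → ℝ) (x₀ : E4) (r M : ℝ), 0 < r → ContinuousOn f (Metric.ball x₀ r) →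
      (∀ x : E4, dist x x₀ < r → ∀ j : Fin 4, ∃ F : ℂ → ℂ, DifferentiableOn ℂ F (Metric.ball 0 r) ∧
          (∀ a : ℝ, |a| < r → F (a : ℂ) = ((f (x + a • v j) : ℝ) : ℂ)) ∧ ∀ w ∈ Metric.ball (0 : ℂ) r, ‖F w‖ ≤ M) →
      ∃ G : (Fin 4 → ℂ) → ℂ, DifferentiableOn ℂ G (Metric.ball (fun i => ((x₀ i : ℝ) : ℂ)) (c * r)) ∧
        (∀ x : E4, dist x x₀ < c * r → G (fun i => ((x i : ℝ) : ℂ)) = ((f x : ℝ) : ℂ)) ∧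
        ∀ z ∈ Metric.ball (fun i => ((x₀ i : ℝ) : ℂ)) (c * r), ‖G z‖ ≤ M

/-- The coordinate functional of a basis of `ℝ⁴` is given by its matrix: `coords(w)_k = Σᵢ A_{ki} wᵢ`, `A_{ki} = coords(eᵢ)_k`. -/
theorem equivFun_apply_eq_sum (bs : Module.Basis (Fin 4) ℝ E4) (w : E4) (k : Fin 4) :
    bs.equivFun w k = ∑ i, bs.equivFun (EuclideanSpace.single i (1 : ℝ)) k * w i := by
  have hw : w = ∑ i, w i • EuclideanSpace.single i (1 : ℝ) := by
    conv_lhs => rw [← (EuclideanSpace.basisFun (Fin 4) ℝ).sum_repr w]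
    simp [EuclideanSpace.basisFun_apply]
  conv_lhs => rw [hw]
  simp only [map_sum, map_smul, Finset.sum_apply, Pi.smul_apply, smul_eq_mul]
  exact Finset.sum_congr rfl fun i _ => mul_comm _ _

/-- Row-sum bound for the complexified coordinate matrix. -/
theorem norm_sum_mul_le (A : Fin 4 → Fin 4 → ℝ) (u : Fin 4 → ℂ) {δ : ℝ} (hu : ∀ i, ‖u i‖ ≤ δ) (k : Fin 4) :
    ‖∑ i, ((A k i : ℝ) : ℂ) * u i‖ ≤ (∑ i, |A k i|) * δ := by
  calc ‖∑ i, ((A k i : ℝ) : ℂ) * u i‖ ≤ ∑ i, ‖((A k i : ℝ) : ℂ) * u i‖ := norm_sum_le _ _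
    _ = ∑ i, |A k i| * ‖u i‖ := by simp
    _ ≤ ∑ i, |A k i| * δ := Finset.sum_le_sum fun i _ => mul_le_mul_of_nonneg_left (hu i) (abs_nonneg _)
    _ = (∑ i, |A k i|) * δ := (Finset.sum_mul _ _ _).symm

/-- **RUNG R-S1×⁺ (by name): `QuantitativeCrossAnalyticity`.** -/
theorem quantitativeCrossAnalyticity_holds : QuantitativeCrossAnalyticity := by
  intro v hv
  -- the basis, its coordinate matrix, the frame size and the universal polydisc radius at scale 1
  obtain ⟨bs, hbs⟩ : ∃ bs : Module.Basis (Fin 4) ℝ E4, ∀ j, bs j = v j :=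
    ⟨basisOfLinearIndependentOfCardEqFinrank hv (by simp), fun j => by
      rw [coe_basisOfLinearIndependentOfCardEqFinrank]⟩
  obtain ⟨A, hA⟩ : ∃ A : Fin 4 → Fin 4 → ℝ, A = fun k i => bs.equivFun (EuclideanSpace.single i (1 : ℝ)) k := ⟨_, rfl⟩
  obtain ⟨Amax, hAmax⟩ : ∃ Amax : ℝ, Amax = ∑ k, ∑ i, |A k i| := ⟨_, rfl⟩
  have hAmax0 : 0 ≤ Amax := by rw [hAmax]; positivity
  have hrow : ∀ k, ∑ i, |A k i| ≤ Amax := fun k => by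
    rw [hAmax]
    exact Finset.single_le_sum (f := fun k => ∑ i, |A k i|) (fun k _ => by positivity) (Finset.mem_univ k)
  obtain ⟨S, hS⟩ : ∃ S : ℝ, S = ∑ j, ‖v j‖ := ⟨_, rfl⟩
  have hS0 : 0 ≤ S := by rw [hS]; positivity
  obtain ⟨r₁, hr₁, hcross⟩ :=
    Literature.Analysis.Complex.exists_holomorphic_extension_of_separately_local_fintype (ι := Fin 4) 1 one_pos
  refine ⟨r₁ / (2 * (S + 1) * (Amax + 1)), by positivity, ?_⟩
  intro f x₀ r M hr _ hext
  -- the scale and the scaled frame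
  obtain ⟨s, hsdef⟩ : ∃ s : ℝ, s = r / (2 * (S + 1)) := ⟨_, rfl⟩
  have hs : 0 < s := by rw [hsdef]; positivity
  have hsr : s < r := by
    rw [hsdef, div_lt_iff₀ (by positivity)]
    nlinarith
  obtain ⟨v', hv'⟩ : ∃ v' : Fin 4 → E4, v' = fun j => s • v j := ⟨_, rfl⟩
  have h1S : 1 * ∑ j, ‖v' j‖ < r := by
    have h1 : ∑ j, ‖v' j‖ = s * S := by
      rw [hv', hS, Finset.mul_sum]
      exact Finset.sum_congr rfl fun j _ => by rw [norm_smul, Real.norm_eq_abs, abs_of_pos hs]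
    rw [one_mul, h1, hsdef, div_mul_eq_mul_div, div_lt_iff₀ (by positivity)]
    nlinarith
  -- the scaled cube function and the hypotheses of the cross theorem at scale 1
  set P : (Fin 4 → ℝ) → ℂ := fun y => ((f (x₀ + ∑ j, y j • v' j) : ℝ) : ℂ) with hP
  have hPb : ∀ y : Fin 4 → ℝ, (∀ k, |y k| < 1) → ‖P y‖ ≤ M := by
    intro y hy
    obtain ⟨F, -, hFr, hFb⟩ := hext (x₀ + ∑ j, y j • v' j) (dist_sum_smul_lt v' x₀ h1S y fun j => (hy j).le) 0
    have h1 := hFr 0 (by simpa using hr)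
    rw [Complex.ofReal_zero, zero_smul, add_zero] at h1
    have h2 := hFb 0 (mem_ball_self hr)
    rw [h1] at h2
    simpa [hP] using h2
  have hPext : ∀ (k : Fin 4) (y : Fin 4 → ℝ), (∀ j, |y j| < 1) → ∃ g : ℂ → ℂ,
      DifferentiableOn ℂ g (ball (0 : ℂ) 1) ∧ (∀ w ∈ ball (0 : ℂ) 1, ‖g w‖ ≤ M) ∧
      ∀ t : ℝ, |t| < 1 → g t = P (Function.update y k t) := by
    intro k y hy
    have hc : ∀ j, |Function.update y k 0 j| ≤ 1 := by
      intro j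
      rcases eq_or_ne j k with hj | hj
      · subst hj; simp
      · rw [Function.update_of_ne hj]; exact (hy j).le
    obtain ⟨F, hFd, hFr, hFb⟩ := hext (x₀ + ∑ j, Function.update y k 0 j • v' j) (dist_sum_smul_lt v' x₀ h1S _ hc) k
    have hmaps : ∀ w : ℂ, w ∈ ball (0 : ℂ) 1 → (s : ℂ) * w ∈ ball (0 : ℂ) r := by
      intro w hw
      rw [mem_ball_zero_iff] at hw ⊢
      rw [norm_mul, Complex.norm_real, Real.norm_eq_abs, abs_of_pos hs]
      nlinarith [norm_nonneg w]
    refine ⟨fun w => F ((s : ℂ) * w), hFd.comp (by fun_prop) fun w hw => hmaps w hw,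
      fun w hw => hFb _ (hmaps w hw), fun t ht => ?_⟩
    have hst : |s * t| < r := by
      rw [abs_mul, abs_of_pos hs]
      have := abs_nonneg t
      nlinarith
    have e1 : ((s : ℂ) * (t : ℂ)) = ((s * t : ℝ) : ℂ) := by push_cast; ring
    simp only
    rw [e1, hFr (s * t) hst]
    simp only [hP]
    rw [sum_update_smul v' y k t, add_assoc, hv']
    simp only [smul_smul, mul_comm t s]
  obtain ⟨G₁, hG₁d, hG₁b, hG₁r⟩ := hcross M P hPb hPext
  -- the complexified affine change of coordinates
  obtain ⟨Λ, hΛ⟩ : ∃ Λ : (Fin 4 → ℂ) → (Fin 4 → ℂ),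
      Λ = fun z k => (s : ℂ)⁻¹ * ∑ i, ((A k i : ℝ) : ℂ) * (z i - ((x₀ i : ℝ) : ℂ)) := ⟨_, rfl⟩
  have hΛd : Differentiable ℂ Λ := by
    rw [hΛ]
    exact differentiable_pi.2 fun k => by fun_prop
  have hkey : s⁻¹ * Amax * (r₁ / (2 * (S + 1) * (Amax + 1)) * r) < r₁ := by
    rw [hsdef]
    have h1 : (r / (2 * (S + 1)))⁻¹ * Amax * (r₁ / (2 * (S + 1) * (Amax + 1)) * r) = r₁ * (Amax / (Amax + 1)) := by
      field_simp
    rw [h1]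
    have h2 : Amax / (Amax + 1) < 1 := (div_lt_one (by positivity)).2 (by linarith)
    nlinarith
  have hΛmaps : ∀ z ∈ ball (fun i => ((x₀ i : ℝ) : ℂ)) (r₁ / (2 * (S + 1) * (Amax + 1)) * r), ∀ k, ‖Λ z k‖ < r₁ := by
    intro z hz k
    have hzi : ∀ i, ‖z i - ((x₀ i : ℝ) : ℂ)‖ ≤ r₁ / (2 * (S + 1) * (Amax + 1)) * r := fun i => by
      rw [← dist_eq_norm]; exact (((dist_pi_lt_iff (by positivity)).1 hz) i).le
    rw [hΛ]
    simp only [norm_mul, norm_inv, Complex.norm_real, Real.norm_eq_abs, abs_of_pos hs]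
    calc s⁻¹ * ‖∑ i, ((A k i : ℝ) : ℂ) * (z i - ((x₀ i : ℝ) : ℂ))‖
        ≤ s⁻¹ * ((∑ i, |A k i|) * (r₁ / (2 * (S + 1) * (Amax + 1)) * r)) :=
          mul_le_mul_of_nonneg_left (norm_sum_mul_le A _ hzi k) (inv_nonneg.2 hs.le)
      _ ≤ s⁻¹ * (Amax * (r₁ / (2 * (S + 1) * (Amax + 1)) * r)) := by gcongr; exact hrow k
      _ = s⁻¹ * Amax * (r₁ / (2 * (S + 1) * (Amax + 1)) * r) := by ring
      _ < r₁ := hkey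
  refine ⟨fun z => G₁ (Λ z), hG₁d.comp hΛd.differentiableOn fun z hz => hΛmaps z hz, ?_, fun z hz => hG₁b _ (hΛmaps z hz)⟩
  -- real points
  intro x hx
  obtain ⟨y, hy⟩ : ∃ y : Fin 4 → ℝ, y = fun k => s⁻¹ * bs.equivFun (x - x₀) k := ⟨_, rfl⟩
  have hΛx : Λ (fun i => ((x i : ℝ) : ℂ)) = fun k => ((y k : ℝ) : ℂ) := by
    ext k
    rw [hΛ, hy]
    simp only
    rw [equivFun_apply_eq_sum bs (x - x₀) k, hA]
    simp only [WithLp.ofLp_sub, Pi.sub_apply]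
    push_cast
    rfl
  have hyk : ∀ k, |y k| < r₁ := by
    intro k
    have hxz : (fun i => ((x i : ℝ) : ℂ)) ∈ ball (fun i => ((x₀ i : ℝ) : ℂ)) (r₁ / (2 * (S + 1) * (Amax + 1)) * r) := by
      rw [mem_ball, dist_pi_lt_iff (by positivity)]
      intro i
      rw [dist_eq_norm, ← Complex.ofReal_sub, Complex.norm_real, ← PiLp.sub_apply]
      exact lt_of_le_of_lt (by simpa [dist_eq_norm] using PiLp.norm_apply_le (x - x₀) i) hx
    have := hΛmaps _ hxz k
    rw [hΛx] at this
    simpa using this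
  show G₁ (Λ fun i => ((x i : ℝ) : ℂ)) = ((f x : ℝ) : ℂ)
  rw [hΛx, hG₁r y hyk]
  simp only [hP]
  congr 2
  have h1 : ∑ j, y j • v' j = x - x₀ := by
    conv_rhs => rw [← bs.sum_equivFun (x - x₀)]
    refine Finset.sum_congr rfl fun j _ => ?_
    rw [hv', hy, hbs]
    simp only [smul_smul]
    congr 1
    field_simp
  rw [h1, add_sub_cancel]

end Summit.QuantumFields.YangMills.Theorems.F4SubCurvatureDoorQuantitativeCrossAnalyticityRegistered

end
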